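import Mathlib
import Summits.AtomisticToContinuum.BoseEinsteinCondensation.Theorems.PuffFloor.Negative.AntiCorrelatedWitness
import HarnessLib

/-!
# Small model for crux `PuffFloor` (stmt-AtomisticToContinuum-11785): the free gas satisfies the floor

Negative-side support file (refuter, cdisprove seat) for crux `PuffFloor` of route
`BECConjugateDomination`: the one computable instance of the crux. For `v ≡ 0` (a member of the
smooth class) and EVERY `N ≥ 1`, `L > 0`:

* `exists_eq_const_of_kinetic_zero` — a periodic trial state with `∫_{Λᴺ} |∇Ψ|² = 0` is constant
  on the cell `[0,L)^{3N}` (all partial derivatives vanish on the open box `(0,L)^{3N}` by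
  `lintegral_cellN_pos`; mean value theorem on the convex open box; continuity along the inward
  diagonal for boundary points of the half-open cell);
* `structureFactor_eq_one_of_freeMinimiser` — hence every free-gas minimiser
  (`periodicEnergy 0 Ψ = E₀^per(0) = 0`) has `S_m = N⁻¹∫|ρ_m|²|Ψ|² = 1` at every `m ≠ 0`;
* `puffFloor_holds_at_freeGas` — the crux's conclusion at `v ≡ 0` holds with `C = 0`, every `ρ₀`,
  EVERY `n` and every minimiser (`kn/√(kn² + Cρ) ≤ 1 = S_m`, `floor_le_one`).

So a refutation of `PuffFloor` cannot live at the free gas (where, by contrast, the minimality-free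
and near-minimiser variants DO fail: `PuffFloorFalseWithoutMinimality.lean`,
`PuffFloorFalseForNearMinimisers.lean`), and the normalisations of `S` and `kn` in the crux are
confirmed. This is NOT the Theses statement (it is its `v ≡ 0` instance); all `[folklore]`.
-/

noncomputable section

namespace Summit.AtomisticToContinuum.BoseEinsteinCondensation.Theorems.PuffFloor.Negative

open Literature.MathematicalPhysics.QuantumManyBody.BoseGas MeasureTheory Complex Finset
open scoped ComplexConjugate BigOperators ENNReal NNReal

variable {N : ℕ} {L : ℝ}

/-! ### Small model: for the free gas the crux HOLDS with `C = 0` (every minimiser is constant) -/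

/-- The open box `(0,L)^{3N}` inside the cell. [folklore] -/
def openBoxN (N : ℕ) (L : ℝ) : Set (Config N) := {X | ∀ i a, X i a ∈ Set.Ioo 0 L}

/-- The open box is open. [folklore] -/
theorem isOpen_openBoxN (N : ℕ) (L : ℝ) : IsOpen (openBoxN N L) := by
  have hrw : openBoxN N L = ⋂ i, ⋂ a, (fun X : Config N => X i a) ⁻¹' Set.Ioo 0 L := by
    ext X; simp [openBoxN]
  rw [hrw]
  exact isOpen_iInter_of_finite fun i => isOpen_iInter_of_finite fun a =>
    isOpen_Ioo.preimage (by fun_prop)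

/-- The open box is convex. [folklore] -/
theorem convex_openBoxN (N : ℕ) (L : ℝ) : Convex ℝ (openBoxN N L) := by
  intro X hX Y hY s t hs ht hst i a
  have h := convex_Ioo (0 : ℝ) L (hX i a) (hY i a) hs ht hst
  simpa using h

/-- The open box lies in the cell. [folklore] -/
theorem openBoxN_subset_cellN (N : ℕ) (L : ℝ) : openBoxN N L ⊆ cellN N L :=
  fun _ hX i a => Set.Ioo_subset_Ico_self (hX i a)

/-- A continuous linear functional on `Config N` vanishing on all coordinate vectors
`eᵢ ⊗ eₐ` is zero. [folklore] -/
theorem clm_eq_zero_of_apply_single {A : Config N →L[ℝ] ℂ}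
    (h : ∀ (i : Fin N) (a : Fin 3), A (Pi.single i (EuclideanSpace.single a 1)) = 0) : A = 0 := by
  ext v
  have hv : v = ∑ i, Pi.single i (v i) := (Finset.univ_sum_single v).symm
  rw [hv, map_sum, zero_apply]
  refine Finset.sum_eq_zero fun i _ => ?_
  have hlin : (A.toLinearMap.comp (LinearMap.single ℝ (fun _ : Fin N => Space) i)) = 0 := by
    refine (EuclideanSpace.basisFun (Fin 3) ℝ).toBasis.ext fun a => ?_
    simp [h i a]
  have := LinearMap.congr_fun hlin (v i)
  simpa using this

/-- **Zero kinetic energy kills every partial derivative on the open box.** [folklore] -/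
theorem fderiv_eq_zero_of_kinetic_zero (Ψ : PeriodicTrialState N L)
    (h0 : ∫⁻ X in cellN N L, kineticDensity Ψ.ψ X = 0) {X : Config N} (hX : X ∈ openBoxN N L) :
    fderiv ℝ Ψ.ψ X = 0 := by
  refine clm_eq_zero_of_apply_single fun i a => ?_
  by_contra hne
  have hpos := lintegral_cellN_pos (L := L) (continuous_fderiv_config_single Ψ.contDiff i a) hX hne
  have hle : ∫⁻ Y in cellN N L,
      ((‖fderiv ℝ Ψ.ψ Y (Pi.single i (EuclideanSpace.single a 1))‖₊ : ℝ≥0∞)) ^ 2 ≤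
        ∫⁻ Y in cellN N L, kineticDensity Ψ.ψ Y := by
    refine lintegral_mono fun Y => ?_
    unfold kineticDensity
    refine le_trans ?_ (Finset.single_le_sum (f := fun i' : Fin N => ∑ a' : Fin 3,
      ((‖fderiv ℝ Ψ.ψ Y (Pi.single i' (EuclideanSpace.single a' 1))‖₊ : ℝ≥0∞)) ^ 2)
      (fun _ _ => bot_le) (Finset.mem_univ i))
    exact Finset.single_le_sum (f := fun a' : Fin 3 =>
      ((‖fderiv ℝ Ψ.ψ Y (Pi.single i (EuclideanSpace.single a' 1))‖₊ : ℝ≥0∞)) ^ 2)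
      (fun _ _ => bot_le) (Finset.mem_univ a)
  rw [h0] at hle
  exact hpos.ne' (le_antisymm hle bot_le)

/-- **Zero kinetic energy: `Ψ` is constant on the cell** (constant on the convex open box by the
mean value theorem, then on `[0,L)^{3N}` by continuity along the inward diagonal). [folklore] -/
theorem exists_eq_const_of_kinetic_zero (hL : 0 < L) (hN : 0 < N) (Ψ : PeriodicTrialState N L)
    (h0 : ∫⁻ X in cellN N L, kineticDensity Ψ.ψ X = 0) :
    ∃ c : ℂ, ∀ X ∈ cellN N L, Ψ.ψ X = c := by
  haveI : Nonempty (Fin N) := ⟨⟨0, hN⟩⟩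
  set X₀ : Config N := fun _ => (WithLp.toLp 2 (fun _ : Fin 3 => L / 2) : Space) with hX₀def
  have hX₀ : X₀ ∈ openBoxN N L := fun i a => by
    simp only [hX₀def, PiLp.toLp_apply, Set.mem_Ioo]
    constructor <;> linarith
  refine ⟨Ψ.ψ X₀, fun X hX => ?_⟩
  have hdiff : Differentiable ℝ Ψ.ψ := Ψ.contDiff.differentiable (by simp)
  have hconst : ∀ Y ∈ openBoxN N L, Ψ.ψ Y = Ψ.ψ X₀ := fun Y hY =>
    (convex_openBoxN N L).is_const_of_fderivWithin_eq_zero hdiff.differentiableOn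
      (fun Z hZ => by
        rw [fderivWithin_of_isOpen (isOpen_openBoxN N L) hZ]
        exact fderiv_eq_zero_of_kinetic_zero Ψ h0 hZ) hY hX₀
  -- an inward diagonal segment from `X`
  obtain ⟨t₀, ht₀, ht₀'⟩ : ∃ t₀ : ℝ, 0 < t₀ ∧ ∀ i a, X i a + t₀ ≤ L := by
    obtain ⟨p, -, hp⟩ := Finset.exists_min_image Finset.univ
      (fun p : Fin N × Fin 3 => L - X p.1 p.2) Finset.univ_nonempty
    refine ⟨L - X p.1 p.2, by linarith [(hX p.1 p.2).2], fun i a => ?_⟩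
    have := hp (i, a) (Finset.mem_univ _)
    linarith
  set D : Config N := fun _ => (WithLp.toLp 2 (fun _ : Fin 3 => (1 : ℝ)) : Space) with hDdef
  have hseg : ∀ t ∈ Set.Ioo (0 : ℝ) t₀, X + t • D ∈ openBoxN N L := by
    intro t ht i a
    have h1 := (hX i a).1
    have h2 := ht₀' i a
    simp only [hDdef, Pi.add_apply, Pi.smul_apply, PiLp.add_apply, PiLp.smul_apply,
      smul_eq_mul, mul_one, Set.mem_Ioo]
    constructor <;> linarith [ht.1, ht.2]
  have hcont : Continuous fun t : ℝ => Ψ.ψ (X + t • D) :=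
    Ψ.contDiff.continuous.comp (continuous_const.add (continuous_id.smul continuous_const))
  have hEq : Set.EqOn (fun t : ℝ => Ψ.ψ (X + t • D)) (fun _ => Ψ.ψ X₀) (Set.Ioo 0 t₀) :=
    fun t ht => hconst _ (hseg t ht)
  have hcl := hEq.closure hcont continuous_const
  have h0mem : (0 : ℝ) ∈ closure (Set.Ioo (0 : ℝ) t₀) := by
    rw [closure_Ioo ht₀.ne]; exact ⟨le_rfl, ht₀.le⟩
  simpa using hcl h0mem

/-- A state constant on the cell has `|c|²(L³)ᴺ = 1`. [folklore] -/
theorem norm_sq_mul_vol_eq_one (hL : 0 < L) (Ψ : PeriodicTrialState N L) {c : ℂ}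
    (hc : ∀ X ∈ cellN N L, Ψ.ψ X = c) : ‖c‖ ^ 2 * (L ^ 3) ^ N = 1 := by
  have h := Ψ.norm_eq
  rw [setLIntegral_congr_fun (measurableSet_cellN N L)
      (fun X hX => by simp only [hc X hX] : Set.EqOn (fun X => ((‖Ψ.ψ X‖₊ : ℝ≥0∞)) ^ 2)
        (fun _ => ((‖c‖₊ : ℝ≥0∞)) ^ 2) (cellN N L)),
    setLIntegral_const, volume_cellN, coe_nnnorm_sq_eq_ofReal, ← ENNReal.ofReal_pow hL.le,
    ← ENNReal.ofReal_pow (by positivity), ← ENNReal.ofReal_mul (by positivity),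
    ← ENNReal.ofReal_one, ENNReal.ofReal_eq_ofReal_iff (by positivity) zero_le_one] at h
  exact h

/-- **A free-gas minimiser has `S_m = 1` at every mode `m ≠ 0`.** [folklore] -/
theorem structureFactor_eq_one_of_freeMinimiser (hL : 0 < L) (hN : 0 < N)
    (Ψ : PeriodicTrialState N L)
    (hE : periodicEnergy (0 : ℝ → ℝ≥0∞) Ψ = periodicGroundStateEnergy (0 : ℝ → ℝ≥0∞) N L)
    {m : Fin 3 → ℤ} (hm : m ≠ 0) :
    (N : ℝ)⁻¹ * ∫ X in cellN N L, ‖∑ j : Fin N, cellWave L m (X j)‖ ^ 2 * ‖Ψ.ψ X‖ ^ 2 = 1 := by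
  -- zero kinetic energy
  have h0 : ∫⁻ X in cellN N L, kineticDensity Ψ.ψ X = 0 := by
    rw [periodicGroundStateEnergy_zero_eq_zero N hL, periodicEnergy] at hE
    rw [← hE]
    refine lintegral_congr fun X => ?_
    rw [periodicInteraction_zeroPotential, zero_mul, add_zero]
  obtain ⟨c, hc⟩ := exists_eq_const_of_kinetic_zero hL hN Ψ h0
  have hcn := norm_sq_mul_vol_eq_one hL Ψ hc
  have hN' : (0 : ℝ) < N := by exact_mod_cast hN
  rw [setIntegral_congr_fun (measurableSet_cellN N L)
    (fun X hX => by simp only [hc X hX] :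
      Set.EqOn (fun X : Config N => ‖∑ j : Fin N, cellWave L m (X j)‖ ^ 2 * ‖Ψ.ψ X‖ ^ 2)
        (fun X => ‖∑ j : Fin N, cellWave L m (X j)‖ ^ 2 * ‖c‖ ^ 2) (cellN N L))]
  have hfun : (fun X : Config N => ‖∑ j : Fin N, cellWave L m (X j)‖ ^ 2 * ‖c‖ ^ 2) =
      fun X => ‖c‖ ^ 2 * pairCorr L m X + ‖c‖ ^ 2 * N := by
    funext X; rw [pairCorr, planeWaveSum]; ring
  have hi1 : IntegrableOn (fun X : Config N => ‖c‖ ^ 2 * pairCorr L m X) (cellN N L) volume :=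
    (integrableOn_cellN_real L (continuous_pairCorr L m)).const_mul _
  have hi2 : IntegrableOn (fun _ : Config N => ‖c‖ ^ 2 * (N : ℝ)) (cellN N L) volume :=
    integrableOn_const (by
      rw [volume_cellN]; exact ENNReal.pow_ne_top (ENNReal.pow_ne_top ENNReal.ofReal_ne_top))
  rw [hfun, integral_add hi1 hi2, integral_const_mul, integral_cellN_pairCorr hL hm, mul_zero,
    zero_add, setIntegral_const, measureReal_cellN hL, smul_eq_mul]
  calc (N : ℝ)⁻¹ * ((L ^ 3) ^ N * (‖c‖ ^ 2 * N)) = ‖c‖ ^ 2 * (L ^ 3) ^ N * ((N : ℝ)⁻¹ * N) := by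
        ring
    _ = 1 := by rw [inv_mul_cancel₀ hN'.ne', mul_one, hcn]

/-- The floor never exceeds `1`. [folklore] -/
theorem floor_le_one {k C ρ : ℝ} (hk : 0 ≤ k) (hCρ : 0 ≤ C * ρ) :
    k / Real.sqrt (k ^ 2 + C * ρ) ≤ 1 := by
  rcases eq_or_lt_of_le hk with hk0 | hk0
  · rw [← hk0, zero_div]; exact zero_le_one
  · rw [div_le_one (Real.sqrt_pos.2 (by positivity))]
    calc k = Real.sqrt (k ^ 2) := (Real.sqrt_sq hk).symm
      _ ≤ Real.sqrt (k ^ 2 + C * ρ) := Real.sqrt_le_sqrt (by linarith)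

/-- **Small model `v ≡ 0`: the crux's conclusion HOLDS for the free gas, with `C = 0`, every
`ρ₀`, every `n` and every minimiser** (its minimisers are exactly the states of zero kinetic
energy, i.e. constant on the cell, and those have `S_m = 1 ≥ kn/√(kn² + Cρ)`). So `PuffFloor`
restricted to the free gas is true — the smooth class is not where a refutation can live without
interaction, and the normalisations of `S`, `kn` in the crux are the right ones. [folklore] -/
theorem puffFloor_holds_at_freeGas :
    ∃ C : ℝ, 0 ≤ C ∧ ∃ ρ₀ : ℝ, 0 < ρ₀ ∧ ∀ ρ : ℝ, 0 < ρ → ρ < ρ₀ →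
      ∀ᶠ n : ℕ in Filter.atTop, ∀ Ψ : PeriodicTrialState (n + 1) (sideLength ρ (n + 1)),
        (let L : ℝ := sideLength ρ (n + 1)
         let S : (Fin 3 → ℤ) → ℝ := fun m => ((n : ℝ) + 1)⁻¹ *
           ∫ X in cellN (n + 1) L, ‖∑ j : Fin (n + 1), cellWave L m (X j)‖ ^ 2 * ‖Ψ.ψ X‖ ^ 2
         let kn : (Fin 3 → ℤ) → ℝ := fun m => ‖((2 * Real.pi / L) • latticeVec 1 m)‖
         periodicEnergy (0 : ℝ → ℝ≥0∞) Ψ = periodicGroundStateEnergy (0 : ℝ → ℝ≥0∞) (n + 1) L →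
           periodicEnergy (0 : ℝ → ℝ≥0∞) Ψ ≠ ⊤ →
           (∀ X, Ψ.ψ X = (‖Ψ.ψ X‖ : ℂ)) → (∀ X, Ψ.ψ X ≠ 0) →
           ∀ m : Fin 3 → ℤ, m ≠ 0 → kn m / Real.sqrt (kn m ^ 2 + C * ρ) ≤ S m) := by
  refine ⟨0, le_rfl, 1, one_pos, fun ρ hρ _ => Filter.Eventually.of_forall fun n Ψ => ?_⟩
  intro L S kn hE _ _ _ m hm
  have hL : 0 < L := Real.rpow_pos_of_pos (by positivity) _
  have hS : S m = 1 := by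
    have h := structureFactor_eq_one_of_freeMinimiser hL (Nat.succ_pos n) Ψ hE hm
    push_cast at h
    exact h
  rw [hS]
  exact floor_le_one (norm_nonneg _) (by positivity)

end Summit.AtomisticToContinuum.BoseEinsteinCondensation.Theorems.PuffFloor.Negative

end
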